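import Summits.AnomalousDissipation.AnomalousDissipation.Theorems.SolenoidalFractalHomogenisationLagrangianStepCellChainSetup
import Summits.AnomalousDissipation.AnomalousDissipation.Theorems.SolenoidalFractalHomogenisationLagrangianStepCellChainGap
import Summits.AnomalousDissipation.AnomalousDissipation.Theorems.SolenoidalFractalHomogenisationLagrangianStepOneLevelSplitDefsW7
import HarnessLib

/-!
# K1L_D `LagrangianRenormalisationStepDesign` (stmt-AnomalousDissipation-27980), W7 engine regime (R1)/(R-c): `ClassDecayW` ON THE FAR CLASSES BY BARE
# DISSIPATION — every weak cell solution from a class-pair datum whose class stays at distance `≥ κ·n` from the lattice `nℤ³` decays at the ν-UNIFORM rate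
# `cK·ν`, `cK = 4π²·lo·κ²/Λ`, with prefactor `CK = 1` (helper; `--supports stmt-AnomalousDissipation-27980`)

Summits-side helper file of route `SolenoidalFractalHomogenisation` (prover seat `ad-k1l-cellLawV-w1` g4; planner ad-ideate-p4 g13 memo §4 (R1) «`k̃ ≥ k̃_*`: bare
dissipation, no functional»; tenure 22:16:05Z (R-c)).  Everything proved; no definitions, no named facts, no sorry.

`classDecayW_bare`: for EVERY word `W`, pre-stretch `M`, window `(lo, hi, Λ, β)` with `0 < lo`, `0 ≤ hi`, `1 ≤ Λ`, every `ν₀, Kb` and every `κ > 0`,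
`ClassDecayW W M hM lo hi Λ β ν₀ Kb 1 (4π²·lo·κ²/Λ) (fun n ν ℓ => ∀ z, κ·n ≤ ‖ℓ + n·z‖)` — the admissibility predicate «the Bloch class of `ℓ` is at
distance `≥ κ·n` from `nℤ³`» (cell units: `k̃ ≥ κ`).  Proof = the mode calculus of this lane: `classDecayW_setup` (window of the weak-form tensor, energy
representative `E` with `E' = −2Q`, class-pair confinement), the spectral gap `|k|² ≥ κ²n²` on the carried modes, `ae_gap_lower_bound` (`4π²·lo'·κ²n²·E ≤ Q`,
`lo' = ν·lo/(Λn²)`), and `energy_le_exp_of_gap` (p5 g10's AC Grönwall).  With `classDecayW_mono` this is the far-class input of the W7 splice; the near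
classes (`k̃ < κ`) are the three-mode engine's (assembly owner ad-sawtooth-k1loc-p1 g11).
NOT a proof of `stub_compactRange`/`stub_largeR` (their predicates are the label RATIO `r = dist/(nν)`, not `k̃`), of the crux, or of anomalous dissipation;
rung F-D1.A0 infrastructure.
-/

set_option linter.dupNamespace false

noncomputable section

namespace Summit.AnomalousDissipation.AnomalousDissipation.Theorems.SolenoidalFractalHomogenisation.LagrangianStep.CellChain

open Set MeasureTheory Filter Topology Function Complex UnitAddTorus
open scoped InnerProductSpace ComplexConjugate ENNReal
open Literature.Analysis Literature.Analysis.FunctionSpaces Literature.Analysis.FunctionSpaces.Torus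
open Literature.Analysis.FluidPDE Literature.Analysis.FluidPDE.Torus Literature.Analysis.FluidPDE.LatticeShear
open Summit.AnomalousDissipation.AnomalousDissipation.Theorems.SolenoidalFractalHomogenisation.RealisedQuasiStaticCellLaw
open Summit.AnomalousDissipation.AnomalousDissipation.Theorems.SolenoidalFractalHomogenisation.LagrangianStep

/-- Modes of the class pair `(ℓ + nℤ³) ∪ (−ℓ + nℤ³)` are at least as far from the origin as the class is from the lattice: if `κ·n ≤ ‖ℓ + n·z‖` for all `z`,
then every `k'` in the pair has `κ²·n² ≤ |k'|²`. [folklore] -/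
theorem freqNormSq_ge_of_classPair {n : ℕ} {κ : ℝ} (hκ : 0 ≤ κ) {ℓ k' : Fin 3 → ℤ}
    (hfar : ∀ z : Fin 3 → ℤ, κ * n ≤ ‖Torus.latticeVec (ℓ + (n : ℤ) • z)‖)
    (hk' : (∃ z : Fin 3 → ℤ, k' = ℓ + (n : ℤ) • z) ∨ (∃ z : Fin 3 → ℤ, k' = -ℓ + (n : ℤ) • z)) :
    κ ^ 2 * (n : ℝ) ^ 2 ≤ freqNormSq k' := by
  have hn : 0 ≤ κ * n := by positivity
  rw [← norm_latticeVec_sq', ← mul_pow]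
  rcases hk' with ⟨z, rfl⟩ | ⟨z, rfl⟩
  · exact pow_le_pow_left₀ hn (hfar z) 2
  · have e : -ℓ + (n : ℤ) • z = -(ℓ + (n : ℤ) • (-z)) := by rw [smul_neg]; abel
    rw [e, latticeVec_neg, norm_neg]
    exact pow_le_pow_left₀ hn (hfar (-z)) 2

/-- **`ClassDecayW` ON THE FAR CLASSES BY BARE DISSIPATION** (regime (R1)/(R-c) of the W7 engine): for every word, pre-stretch, window with `0 < lo`,
`0 ≤ hi`, `1 ≤ Λ`, every `ν₀, Kb, κ > 0`:
`ClassDecayW W M hM lo hi Λ β ν₀ Kb 1 (4π²·lo·κ²/Λ) (fun n ν ℓ => ∀ z, κ·n ≤ ‖ℓ + n·z‖)`. [cite: Temam1984, Ch. III §1 Lemma 1.2 (energy inequality)] -/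
theorem classDecayW_bare {k : ℕ} (W : LatticeWord k) (M : ℝ) (hM : 0 < M) {lo hi Λ : ℝ} (hlo : 0 < lo) (hhi : 0 ≤ hi) (hΛ : 1 ≤ Λ)
    (β ν₀ Kb : ℝ) {κ : ℝ} (hκ : 0 < κ) :
    ClassDecayW W M hM lo hi Λ β ν₀ Kb 1 (4 * Real.pi ^ 2 * lo * κ ^ 2 / Λ)
      (fun n _ ℓ => ∀ z : Fin 3 → ℤ, κ * n ≤ ‖Torus.latticeVec (ℓ + (n : ℤ) • z)‖) := by
  intro ν hν n hn 𝔸 _ hwin L _ _ ℓ _ hfar F hF hsupp T hT u hu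
  have hn0 : 0 < n := hn
  have hnR : (0:ℝ) < n := by exact_mod_cast hn0
  have hΛ0 : 0 < Λ := lt_of_lt_of_le one_pos hΛ
  obtain ⟨hN, ⟨hF2, hFi, hFdiv⟩, ⟨E, Q, hE0, _, _, _, hAC, hEae, _, _, hEd, hQblock, _⟩, hclass, _⟩ :=
    classDecayW_setup W M hM hlo hhi hΛ hν.1 hn hwin ℓ hF hsupp hT hu
  -- the spectral gap on the carried modes
  have hlo' : 0 ≤ (1 / (n:ℝ) ^ 2) * (ν * (lo / Λ)) := by
    have := hν.1
    positivity
  have hgap : ∀ᵐ t ∂(volume.restrict (Ioo 0 T)), ∀ k', mFourierCoeff (EuclideanSpace.complexify ∘ u t) k' ≠ 0 →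
      κ ^ 2 * (n : ℝ) ^ 2 ≤ freqNormSq k' := by
    filter_upwards [hclass] with t ht k' hk'
    have hmem : (∃ z : Fin 3 → ℤ, k' = ℓ + (n : ℤ) • z) ∨ (∃ z : Fin 3 → ℤ, k' = -ℓ + (n : ℤ) • z) := by
      by_contra hcon
      rw [not_or] at hcon
      exact hk' (ht k' hcon.1 hcon.2)
    exact freqNormSq_ge_of_classPair hκ.le hfar hmem
  have hlow := ae_gap_lower_bound hu hN hlo' hEae hQblock (ρ := κ ^ 2 * (n : ℝ) ^ 2) (by positivity) hgap
  -- bare exponential decay of the representative, then of the energy a.e.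
  have hdec : ∀ t ∈ Icc 0 T, E t ≤ Real.exp (-(8 * Real.pi ^ 2 * ((1 / (n:ℝ) ^ 2) * (ν * (lo / Λ))) * (κ ^ 2 * (n : ℝ) ^ 2) * t)) * E 0 :=
    fun t ht => energy_le_exp_of_gap hAC hEd hlow ht
  filter_upwards [hEae, ae_restrict_mem measurableSet_Ioo] with t hEt htI
  rw [← hEt]
  have h1 := hdec t ⟨htI.1.le, htI.2.le⟩
  rw [hE0] at h1
  have e : 8 * Real.pi ^ 2 * ((1 / (n:ℝ) ^ 2) * (ν * (lo / Λ))) * (κ ^ 2 * (n : ℝ) ^ 2) * t =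
      2 * (4 * Real.pi ^ 2 * lo * κ ^ 2 / Λ) * ν * t := by
    field_simp
    ring
  rw [e, ← one_mul (Real.exp _)] at h1
  exact h1

end Summit.AnomalousDissipation.AnomalousDissipation.Theorems.SolenoidalFractalHomogenisation.LagrangianStep.CellChain

end
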